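import Summits.Ventures.CertifiedManyBodySolver.Theorems.M3x2EdgeSplitSymReplayOutRouteHS
import HarnessLib

/-!
# SymReplay — chunked assembly of per-module fact families (E-class glue item (1), pen hub-lb-sym-plan-1 g4, STATUS l.1961)

At E-class the closing `energyDensity_ge_of_outroutePM … hfacts` takes `hfacts : OutFactsP lo hi oP S 0 J` with J ≈ 100–350
(EBUDGET-600 §9c).  `⟨out_0, …, out_{J−1}, trivial⟩` is then a J-deep nested term; these two lemmas let the Cert module assemble
it in blocks (e.g. one block per data file) and append.  Proof script CHECKED on a mock with the identical recursion shape
(`glue/FactsAppend.lean`, rc 0); this file becomes checkable once `…OutRouteHS` (p657615) is built.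

USAGE: `hfacts := outFactsP_append lo hi oP S 64 0 (J − 64) ⟨out_0, …, out_63, trivial⟩ (outFactsP_append … 64 64 (J − 128) ⟨out_64, …⟩ …)`.
HONEST FRAMING: glue; no certificate is replayed; no bound of record moves; no summit or crux statement is proved.
-/

namespace Summit.Ventures.CertifiedManyBodySolver.Theorems.SymReplay.PenGlue

open Literature.MathematicalPhysics.QuantumLattice
open Literature.MathematicalPhysics.QuantumLattice.HubbardWave0
open Literature.Probability.LatticeModels

/-- **Chunked assembly, packed facts**: facts for modules `[i, i+m)` and `[i+m, i+m+n)` give facts for `[i, i+m+n)`. -/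
theorem outFactsP_append (lo hi : ℤ × ℤ) (oP : PackedNF.PWord → PackedNF.PHint) (S : ℕ → QPoly) :
    ∀ (m i n : ℕ), OutFactsP lo hi oP S i m → OutFactsP lo hi oP S (i + m) n → OutFactsP lo hi oP S i (m + n)
  | 0, i, n, _, hg => by simpa [Nat.zero_add] using hg
  | m + 1, i, n, hf, hg => by
    rw [Nat.add_right_comm]
    exact ⟨hf.1, outFactsP_append lo hi oP S m (i + 1) n hf.2 (by simpa [Nat.add_assoc, Nat.add_comm 1 m] using hg)⟩

/-- **Chunked assembly, hinted tree facts** (substituted skeleton). -/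
theorem outFactsHS_append (K : SymCertR) (oracle : Word → HintT) (S : ℕ → QPoly) :
    ∀ (m i n : ℕ), OutFactsHS K oracle S i m → OutFactsHS K oracle S (i + m) n → OutFactsHS K oracle S i (m + n)
  | 0, i, n, _, hg => by simpa [Nat.zero_add] using hg
  | m + 1, i, n, hf, hg => by
    rw [Nat.add_right_comm]
    exact ⟨hf.1, outFactsHS_append K oracle S m (i + 1) n hf.2 (by simpa [Nat.add_assoc, Nat.add_comm 1 m] using hg)⟩

end Summit.Ventures.CertifiedManyBodySolver.Theorems.SymReplay.PenGlue
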